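import Summits.RiemannHypothesis.RiemannHypothesis.Theorems.PfPersistenceCoefficientRigidity
import Summits.RiemannHypothesis.RiemannHypothesis.Theorems.PfPersistenceDownCone
import HarnessLib

/-!
# PF persistence campaign (cell `pub-rhpf`, seat cand-7, gen 9): COEFFICIENT RIGIDITY, part 2 —
eventual detection, prime-power deletion, Euler-factor deletion

Mechanism/rigidity campaign; **no RH claims**.  Everything here is PROVED (Mathlib + tree theorems;
no named fact, no `sorry`) and RH-free, from part 1 (`PfPersistenceCoefficientRigidity.lean`: the
hairline `|λ| ≤ 2 ε(r)`, `0 < r < x₀/2`, for perturbations positive on test functions, and its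
doubly-exponential form `siteQuadratic_hairline`).

* `exists_siteQuadratic_neg_eventually` — there is `X` such that at every site `x₀ ≥ X` every
  single-site perturbation with `|λ| > e^{-x₀}` is negative on some test function.
* `eq_zero_of_frequently_nonneg` — a fixed `λ` positive at arbitrarily large sites is `0`.
* `primePower_deletion_exists_neg` — **deleting any single prime power `n ≥ N₀` from `ζ`'s
  explicit formula (`λ = Λ(n)/√n`, `x₀ = log n`) destroys positivity** (PROVED, RH-free).
* `deleteTable_quadratic_eq_siteQuadratic`, `deleteTable_not_positivity_eventually` — the dictionary
  with the campaign's weight tables (`PfPersistenceDownCone`): `tableDatum (deleteTable {n})` fails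
  `ExplicitDatum.Positivity` for every prime power `n ≥ N₀` (PROVED, RH-free).
* `towerQuadratic`, `exists_towerQuadratic_neg_of_test`, `eulerFactor_deletion_exists_neg` — the same
  for the whole Euler factor at `p` (all powers `p^{k+1}`, weights `log p / p^{(k+1)/2}`, any
  truncation `K ≥ 1`): the polarised witness does not see the higher sites.
Whether the UNperturbed functional is positive is exactly RH
(`siteQuadratic_zero_nonneg_iff_riemannHypothesis`, part 1) and is not claimed either way.  Positivity
hypotheses are stated inline; no `Prop` is vendored.

References: E. Bombieri, *Remarks on Weil's quadratic functional in the theory of prime numbers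
I*, Rend. Lincei (9) 11 (2000) 183–233, §3.
-/

set_option linter.dupNamespace false

noncomputable section

open Complex Filter Set MeasureTheory
open scoped Real Topology ComplexConjugate

namespace Summit.RiemannHypothesis.RiemannHypothesis.Theorems.PfPersistenceCoefficientRigidity

open Literature.NumberTheory.LFunctions
open Literature.NumberTheory.LFunctions.WeilConverse
open Summit.RiemannHypothesis.RiemannHypothesis.Theorems.PfPersistenceDownCone
open Summit.RiemannHypothesis.RiemannHypothesis.Theorems.PfPersistenceBarrier

/-! ## §6 Eventual detection (RH-free) -/

/-- **From the hairline to a single exponential**: there is `X` such that for `x₀ ≥ X` any `t`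
obeying the hairline inequalities `|t| ≤ 2 ε(r)` for all `1 ≤ r < x₀/2` has `|t| ≤ e^{-x₀}`
(`ε(r) ≤ C e^{-c e^{2r}}`, `weilGroundEnergy_exp_exp_decay`, at `r = (x₀-1)/2`, and
`e^{x} ≥ 1 + x + x²/2`). [this work] -/
theorem abs_le_exp_neg_of_hairline : ∃ X : ℝ, ∀ x₀ t : ℝ, X ≤ x₀ →
    (∀ r : ℝ, 1 ≤ r → 2 * r < x₀ → |t| ≤ 2 * weilGroundEnergy r) → |t| ≤ Real.exp (-x₀) := by
  obtain ⟨c, hc, C, hC⟩ := weilGroundEnergy_exp_exp_decay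
  set κ : ℝ := c / Real.exp 1 with hκ
  have hκ0 : 0 < κ := div_pos hc (Real.exp_pos 1)
  refine ⟨max (max 3 (8 / κ)) (2 * |C|), fun x₀ t hX hH ↦ ?_⟩
  have hx3 : 3 ≤ x₀ := (le_max_left _ _).trans ((le_max_left _ _).trans hX)
  have hx8 : 8 / κ ≤ x₀ := (le_max_right _ _).trans ((le_max_left _ _).trans hX)
  have hxC : 2 * |C| ≤ x₀ := (le_max_right _ _).trans hX
  have h1 : |t| ≤ 2 * C * Real.exp (-c * Real.exp (2 * ((x₀ - 1) / 2))) := by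
    have ha := hH ((x₀ - 1) / 2) (by linarith) (by linarith)
    have hb := hC ((x₀ - 1) / 2) (by linarith)
    linarith
  have hE : Real.exp (2 * ((x₀ - 1) / 2)) = Real.exp x₀ / Real.exp 1 := by
    rw [show 2 * ((x₀ - 1) / 2) = x₀ - 1 by ring, Real.exp_sub]
  rw [hE, show -c * (Real.exp x₀ / Real.exp 1) = -(κ * Real.exp x₀) by rw [hκ]; ring] at h1
  have hex : x₀ ≤ κ * Real.exp x₀ - x₀ := by
    have hq : 1 + x₀ + x₀ ^ 2 / 2 ≤ Real.exp x₀ := Real.quadratic_le_exp_of_nonneg (by linarith)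
    have h8 : 8 ≤ κ * x₀ := by
      have := (div_le_iff₀ hκ0).1 hx8; linarith
    nlinarith
  have h2 : 2 * C * Real.exp (-(κ * Real.exp x₀)) ≤ Real.exp (-x₀) := by
    have hpos := Real.exp_pos (-(κ * Real.exp x₀))
    have h3 : 2 * C ≤ Real.exp (κ * Real.exp x₀ - x₀) := by
      calc 2 * C ≤ 2 * |C| := by linarith [le_abs_self C]
        _ ≤ x₀ := hxC
        _ ≤ κ * Real.exp x₀ - x₀ := hex
        _ ≤ (κ * Real.exp x₀ - x₀) + 1 := by linarith
        _ ≤ Real.exp (κ * Real.exp x₀ - x₀) := Real.add_one_le_exp _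
    calc 2 * C * Real.exp (-(κ * Real.exp x₀))
        ≤ Real.exp (κ * Real.exp x₀ - x₀) * Real.exp (-(κ * Real.exp x₀)) :=
          mul_le_mul_of_nonneg_right h3 hpos.le
      _ = Real.exp (-x₀) := by rw [← Real.exp_add]; ring_nf
  linarith

/-- **EVENTUAL DETECTION (RH-free)**: there is `X` such that at every site `x₀ ≥ X` every
perturbation with `|λ| > e^{-x₀}` is detected: some test function has `Re W_{λ,x₀}(g ⋆ g̃) < 0`.  (The
true threshold is doubly exponential, `siteQuadratic_hairline`.) [this work] -/
theorem exists_siteQuadratic_neg_eventually : ∃ X : ℝ, ∀ x₀ lam : ℝ, X ≤ x₀ →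
    Real.exp (-x₀) < |lam| → ∃ g : ℝ → ℂ, IsWeilTest g ∧ (siteQuadratic lam x₀ g).re < 0 := by
  obtain ⟨X, hX⟩ := abs_le_exp_neg_of_hairline
  refine ⟨X, fun x₀ lam hx hlam ↦ ?_⟩
  by_contra hno
  push Not at hno
  exact (not_lt.2 (hX x₀ lam hx fun r hr hxr ↦
    abs_le_two_mul_weilGroundEnergy_of_nonneg hno (by linarith) hxr)) hlam

/-- **Only `λ = 0` survives all scales (RH-free)**: a fixed `λ` whose single-site perturbation is
positive on test functions at arbitrarily large sites is `0` — with NO claim that `λ = 0` is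
positive (that is RH). [this work] -/
theorem eq_zero_of_frequently_nonneg {lam : ℝ}
    (h : ∀ X : ℝ, ∃ x₀ : ℝ, X ≤ x₀ ∧ ∀ g : ℝ → ℂ, IsWeilTest g → 0 ≤ (siteQuadratic lam x₀ g).re) :
    lam = 0 := by
  obtain ⟨X, hX⟩ := exists_siteQuadratic_neg_eventually
  by_contra hne
  have hpos : 0 < |lam| := abs_pos.2 hne
  obtain ⟨x₀, hx₀, hP⟩ := h (max X (1 - Real.log |lam|))
  obtain ⟨g, hg, hneg⟩ := hX x₀ lam ((le_max_left _ _).trans hx₀) (by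
    rw [← Real.lt_log_iff_exp_lt hpos]
    linarith [(le_max_right _ _).trans hx₀])
  exact absurd (hP g hg) (not_le.2 hneg)

/-! ## §7 Prime-power deletion (RH-free) -/

/-- `Λ(n) ≠ 0 ⟹ log 2 ≤ Λ(n)` (`Λ(n) = log (minFac n)` on prime powers). [folklore] -/
theorem log_two_le_vonMangoldt {n : ℕ} (hn : ArithmeticFunction.vonMangoldt n ≠ 0) :
    Real.log 2 ≤ ArithmeticFunction.vonMangoldt n := by
  have hpp : IsPrimePow n := ArithmeticFunction.vonMangoldt_ne_zero_iff.1 hn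
  rw [ArithmeticFunction.vonMangoldt_apply, if_pos hpp]
  have h2 : 2 ≤ n.minFac := (Nat.minFac_prime hpp.ne_one).two_le
  exact Real.log_le_log two_pos (by exact_mod_cast h2)

/-- The deleted weight beats the detection threshold: `e^{-log n} = 1/n < Λ(n)/√n` for `n ≥ 4`
with `Λ(n) ≠ 0` (`1/√n ≤ 1/2 < log 2 ≤ Λ(n)`). [this work] -/
theorem exp_neg_log_lt_weight {n : ℕ} (hn4 : 4 ≤ n) (hΛ : ArithmeticFunction.vonMangoldt n ≠ 0) :
    Real.exp (-Real.log n) < |ArithmeticFunction.vonMangoldt n / Real.sqrt n| := by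
  have hn4' : (4 : ℝ) ≤ n := by exact_mod_cast hn4
  have hn0 : (0 : ℝ) < n := by linarith
  rw [Real.exp_neg, Real.exp_log hn0]
  have hsq : (2 : ℝ) ≤ Real.sqrt n := by
    rw [show (2 : ℝ) = Real.sqrt (2 ^ 2) from (Real.sqrt_sq zero_le_two).symm]
    exact Real.sqrt_le_sqrt (by linarith)
  have hsq0 : 0 < Real.sqrt n := by linarith
  have hs : Real.sqrt n * Real.sqrt n = n := Real.mul_self_sqrt hn0.le
  rw [abs_of_nonneg (div_nonneg ArithmeticFunction.vonMangoldt_nonneg hsq0.le), lt_div_iff₀ hsq0,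
    inv_mul_lt_iff₀ hn0]
  have hl2 : (0.6931471803 : ℝ) < Real.log 2 := Real.log_two_gt_d9
  have hΛ2 := log_two_le_vonMangoldt hΛ
  have h1 : Real.sqrt n ≤ n / 2 := by nlinarith [mul_le_mul_of_nonneg_right hsq hsq0.le]
  have h2 : (n : ℝ) * Real.log 2 ≤ n * ArithmeticFunction.vonMangoldt n :=
    mul_le_mul_of_nonneg_left hΛ2 hn0.le
  nlinarith [mul_lt_mul_of_pos_left hl2 hn0]

/-- **PRIME-POWER DELETION IS EVENTUALLY NON-POSITIVE (RH-free, PROVED).** There is `N₀` such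
that deleting any single prime power `n ≥ N₀` from `ζ`'s explicit formula — the perturbation
`λ = Λ(n)/√n` at `x₀ = log n` — yields a functional that is negative on some test function.
[this work] -/
theorem primePower_deletion_exists_neg : ∃ N₀ : ℕ, ∀ n : ℕ, N₀ ≤ n →
    ArithmeticFunction.vonMangoldt n ≠ 0 → ∃ g : ℝ → ℂ, IsWeilTest g ∧
      (siteQuadratic (ArithmeticFunction.vonMangoldt n / Real.sqrt n) (Real.log n) g).re < 0 := by
  obtain ⟨X, hX⟩ := exists_siteQuadratic_neg_eventually
  refine ⟨max 4 ⌈Real.exp X⌉₊, fun n hn hΛ ↦ ?_⟩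
  have hn4 : 4 ≤ n := (le_max_left _ _).trans hn
  have hn0 : (0 : ℝ) < n := by exact_mod_cast lt_of_lt_of_le (by norm_num) hn4
  have hnX : Real.exp X ≤ n :=
    (Nat.le_ceil _).trans (by exact_mod_cast (le_max_right _ _).trans hn)
  exact hX (Real.log n) _ ((Real.le_log_iff_exp_le hn0).2 hnX) (exp_neg_log_lt_weight hn4 hΛ)

/-- The same for primes `p ≥ N₀` in the familiar form `λ = log p/√p`. [this work] -/
theorem prime_deletion_exists_neg : ∃ N₀ : ℕ, ∀ p : ℕ, N₀ ≤ p → p.Prime →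
    ∃ g : ℝ → ℂ, IsWeilTest g ∧ (siteQuadratic (Real.log p / Real.sqrt p) (Real.log p) g).re < 0 := by
  obtain ⟨N₀, hN⟩ := primePower_deletion_exists_neg
  refine ⟨N₀, fun p hp hpr ↦ ?_⟩
  have hΛ : ArithmeticFunction.vonMangoldt p ≠ 0 := by
    rw [ArithmeticFunction.vonMangoldt_apply_prime hpr]
    exact (Real.log_pos (by exact_mod_cast hpr.one_lt)).ne'
  have h := hN p hp hΛ
  rwa [ArithmeticFunction.vonMangoldt_apply_prime hpr] at h

/-! ## §8 Deleting a whole Euler factor (the tower of powers of one prime) -/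

/-- The tower perturbation `W(g ⋆ g̃) + ∑_{k<K} μ_k ((g ⋆ g̃)((k+1)x₀) + (g ⋆ g̃)(-(k+1)x₀))`:
deleting the Euler factor of `p` truncated at `p^K` is `μ_k = log p / (√p)^{k+1}`, `x₀ = log p`
(a test function sees only finitely many powers, so every truncation is covered). [this work] -/
def towerQuadratic (μ : ℕ → ℝ) (K : ℕ) (x₀ : ℝ) (g : ℝ → ℂ) : ℂ :=
  weilQuadratic g + ∑ k ∈ Finset.range K,
    (μ k : ℂ) * (weilConv g (weilReflect g) ((k + 1 : ℕ) * x₀) +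
      weilConv g (weilReflect g) (-((k + 1 : ℕ) * x₀)))

/-- A priori bound `Re tower ≤ Re W(g ⋆ g̃) + 2 (∑_{k<K} |μ_k|) ‖g‖₂²`. [this work] -/
theorem towerQuadratic_re_le (μ : ℕ → ℝ) (K : ℕ) (x₀ : ℝ) {g : ℝ → ℂ} (hg : IsWeilTest g) :
    (towerQuadratic μ K x₀ g).re ≤
      (weilQuadratic g).re + 2 * (∑ k ∈ Finset.range K, |μ k|) * ∫ u, ‖g u‖ ^ 2 := by
  rw [towerQuadratic, Complex.add_re, Complex.re_sum]
  have h := fun k ↦ re_siteTerm_le (μ k) ((k + 1 : ℕ) * x₀) hg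
  have h1 : ∑ k ∈ Finset.range K, ((μ k : ℂ) * (weilConv g (weilReflect g) ((k + 1 : ℕ) * x₀) +
      weilConv g (weilReflect g) (-((k + 1 : ℕ) * x₀)))).re ≤
      ∑ k ∈ Finset.range K, 2 * |μ k| * ∫ u, ‖g u‖ ^ 2 :=
    Finset.sum_le_sum fun k _ ↦ h k
  have h2 : ∑ k ∈ Finset.range K, 2 * |μ k| * ∫ u, ‖g u‖ ^ 2 =
      2 * (∑ k ∈ Finset.range K, |μ k|) * ∫ u, ‖g u‖ ^ 2 := by
    rw [Finset.mul_sum, Finset.sum_mul]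
  linarith

/-- The autocorrelation of the polarised test VANISHES at every far site `y > 2r + x₀` (all four
products have disjoint supports). [this work] -/
theorem autocorr_translateMix_far {φ : ℝ → ℂ} {r x₀ y : ℝ} (hφ : tsupport φ ⊆ Icc (-r) r)
    (hx0 : 0 < x₀) (hy : 2 * r + x₀ < y) (c : ℂ) :
    weilConv (translateMix φ c x₀) (weilReflect (translateMix φ c x₀)) y = 0 := by
  rw [weilConv_apply]
  have e : ∀ u : ℝ, translateMix φ c x₀ u * weilReflect (translateMix φ c x₀) (y - u) = 0 := by
    intro u
    have hr : weilReflect (translateMix φ c x₀) (y - u) =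
        conj (φ (u - y)) + conj c * conj (φ (u - y - x₀)) := by
      simp only [weilReflect, translateMix_apply, neg_sub, map_add, map_mul]
    have A : φ u * conj (φ (u - y)) = 0 :=
      mul_conj_eq_zero_of_far hφ ((show 2 * r < u - (u - y) by linarith).trans_le (le_abs_self _))
    have B : φ u * conj (φ (u - y - x₀)) = 0 :=
      mul_conj_eq_zero_of_far hφ
        ((show 2 * r < u - (u - y - x₀) by linarith).trans_le (le_abs_self _))
    have C : φ (u - x₀) * conj (φ (u - y)) = 0 :=
      mul_conj_eq_zero_of_far hφ
        ((show 2 * r < u - x₀ - (u - y) by linarith).trans_le (le_abs_self _))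
    have D : φ (u - x₀) * conj (φ (u - y - x₀)) = 0 :=
      mul_conj_eq_zero_of_far hφ
        ((show 2 * r < u - x₀ - (u - y - x₀) by linarith).trans_le (le_abs_self _))
    rw [hr, translateMix_apply]
    linear_combination A + conj c * B + c * C + c * conj c * D
  simp_rw [e]
  exact integral_zero ℝ ℂ

/-- **Reduction of the tower to the site**: on the polarised test with `2r < x₀` the tower form
equals the single-site form with `λ = μ 0` (the higher sites `(k+1)x₀`, `k ≥ 1`, are invisible).
[this work] -/
theorem towerQuadratic_translateMix_eq {φ : ℝ → ℂ} {r x₀ : ℝ} (hφ : tsupport φ ⊆ Icc (-r) r)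
    (hx0 : 0 < x₀) (hx : 2 * r < x₀) (c : ℂ) (μ : ℕ → ℝ) {K : ℕ} (hK : 1 ≤ K) :
    towerQuadratic μ K x₀ (translateMix φ c x₀) =
      siteQuadratic (μ 0) x₀ (translateMix φ c x₀) := by
  rw [towerQuadratic, siteQuadratic_eq, Finset.sum_eq_single 0]
  · simp
  · intro k _ hk0
    have hk1 : (1 : ℝ) ≤ k := by exact_mod_cast Nat.one_le_iff_ne_zero.2 hk0
    have hy : 2 * r + x₀ < ((k + 1 : ℕ) : ℝ) * x₀ := by
      push_cast; nlinarith [mul_le_mul_of_nonneg_right hk1 hx0.le]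
    have hz := autocorr_translateMix_far hφ hx0 hy c
    have hz' : weilConv (translateMix φ c x₀) (weilReflect (translateMix φ c x₀))
        (-((k + 1 : ℕ) * x₀)) = 0 := by
      rw [← conj_weilConv_weilReflect_neg, neg_neg, hz, map_zero]
    rw [hz, hz', add_zero, mul_zero]
  · intro h0
    exact absurd (Finset.mem_range.2 (by omega)) h0

/-- **DETECTION FOR TOWERS (RH-free).** If a test `φ` of radius `r < x₀/2` has
`2 Re W(φ ⋆ φ̃) < |μ 0| ‖φ‖₂²`, the tower-perturbed form (any real weights at the higher sites, any
truncation `K ≥ 1`) is negative on some test function. [this work] -/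
theorem exists_towerQuadratic_neg_of_test {φ : ℝ → ℂ} (hφ : IsWeilTest φ) {r x₀ : ℝ}
    (hφr : tsupport φ ⊆ Icc (-r) r) (hx0 : 0 < x₀) (hx : 2 * r < x₀) (μ : ℕ → ℝ) {K : ℕ}
    (hK : 1 ≤ K) (hlam : 2 * (weilQuadratic φ).re < |μ 0| * ∫ u, ‖φ u‖ ^ 2) :
    ∃ g : ℝ → ℂ, IsWeilTest g ∧ (towerQuadratic μ K x₀ g).re < 0 := by
  by_cases hRH : RiemannHypothesis
  · obtain ⟨c, -, hneg⟩ :=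
      exists_siteQuadratic_neg_of_riemannHypothesis hRH hφ hφr hx0 hx hlam
    refine ⟨_, isWeilTest_translateMix hφ c x₀, ?_⟩
    rwa [towerQuadratic_translateMix_eq hφr hx0 hx c μ hK]
  · obtain ⟨a, -, -, g, hg, -, hn, hlt⟩ :=
      exists_weilQuadratic_lt_of_not_riemannHypothesis hRH (2 * ∑ k ∈ Finset.range K, |μ k|) 0
    have hle := towerQuadratic_re_le μ K x₀ hg
    rw [hn, mul_one] at hle
    exact ⟨g, hg, by linarith⟩

/-- **TOWER HAIRLINE (RH-free)**: a tower perturbation that is positive on test functions has bottom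
weight `|μ 0| ≤ 2 ε(r)` for every `0 < r < x₀/2`. [this work] -/
theorem abs_le_two_mul_weilGroundEnergy_of_tower_nonneg {μ : ℕ → ℝ} {K : ℕ} {x₀ : ℝ}
    (hK : 1 ≤ K) (hP : ∀ g : ℝ → ℂ, IsWeilTest g → 0 ≤ (towerQuadratic μ K x₀ g).re) {r : ℝ}
    (hr : 0 < r) (hx : 2 * r < x₀) : |μ 0| ≤ 2 * weilGroundEnergy r := by
  refine not_lt.1 fun h ↦ ?_
  have h' : sInf (weilWindowSphereValues (fun _ ↦ True) r) < |μ 0| / 2 := by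
    rw [← weilGroundEnergy_eq_sInf]; linarith
  obtain ⟨x, ⟨φ, hφ, hs, -, hn, rfl⟩, hx'⟩ :=
    exists_lt_of_csInf_lt (weilWindowSphereValues_top_nonempty hr) h'
  obtain ⟨g, hg, hneg⟩ :=
    exists_towerQuadratic_neg_of_test hφ hs (by linarith) hx μ hK (by rw [hn, mul_one]; linarith)
  exact absurd (hP g hg) (not_le.2 hneg)

/-- **EVENTUAL DETECTION FOR TOWERS (RH-free)**: at sites `x₀ ≥ X`, every tower with bottom
weight `|μ 0| > e^{-x₀}` is negative on some test function. [this work] -/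
theorem exists_towerQuadratic_neg_eventually : ∃ X : ℝ, ∀ x₀ : ℝ, ∀ μ : ℕ → ℝ, ∀ K : ℕ,
    1 ≤ K → X ≤ x₀ → Real.exp (-x₀) < |μ 0| →
      ∃ g : ℝ → ℂ, IsWeilTest g ∧ (towerQuadratic μ K x₀ g).re < 0 := by
  obtain ⟨X, hX⟩ := abs_le_exp_neg_of_hairline
  refine ⟨X, fun x₀ μ K hK hx hμ ↦ ?_⟩
  by_contra hno
  push Not at hno
  exact (not_lt.2 (hX x₀ (μ 0) hx fun r hr hxr ↦
    abs_le_two_mul_weilGroundEnergy_of_tower_nonneg hK hno (by linarith) hxr)) hμ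

/-- **EULER-FACTOR DELETION IS EVENTUALLY NON-POSITIVE (RH-free, PROVED).** There is `N₀` such
that for every prime `p ≥ N₀` and every truncation `K ≥ 1`, deleting the powers `p, p², …, p^K`
from `ζ`'s explicit formula (weights `log p/(√p)^{k+1}` at the sites `(k+1) log p`) yields a
functional that is negative on some test function. [this work] -/
theorem eulerFactor_deletion_exists_neg : ∃ N₀ : ℕ, ∀ p : ℕ, N₀ ≤ p → p.Prime →
    ∀ K : ℕ, 1 ≤ K → ∃ g : ℝ → ℂ, IsWeilTest g ∧
      (towerQuadratic (fun k ↦ Real.log p / Real.sqrt p ^ (k + 1)) K (Real.log p) g).re < 0 := by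
  obtain ⟨X, hX⟩ := exists_towerQuadratic_neg_eventually
  refine ⟨max 4 ⌈Real.exp X⌉₊, fun p hp hpr K hK ↦ ?_⟩
  have hp4 : 4 ≤ p := (le_max_left _ _).trans hp
  have hp0 : (0 : ℝ) < p := by exact_mod_cast lt_of_lt_of_le (by norm_num) hp4
  have hpX : Real.exp X ≤ p :=
    (Nat.le_ceil _).trans (by exact_mod_cast (le_max_right _ _).trans hp)
  have hΛ : ArithmeticFunction.vonMangoldt p ≠ 0 := by
    rw [ArithmeticFunction.vonMangoldt_apply_prime hpr]
    exact (Real.log_pos (by exact_mod_cast hpr.one_lt)).ne'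
  refine hX (Real.log p) _ K hK ((Real.le_log_iff_exp_le hp0).2 hpX) ?_
  have h := exp_neg_log_lt_weight hp4 hΛ
  rwa [ArithmeticFunction.vonMangoldt_apply_prime hpr, ← pow_one (Real.sqrt p)] at h

/-! ## §9 Dictionary with the campaign's weight tables (`PfPersistenceDownCone`) -/

/-- **The deleted table IS the site perturbation**: for the explicit datum of `ζ`'s weight table with
the single entry `n₀` deleted (`tableDatum (deleteTable {n₀})`, `PfPersistenceDownCone`),
`Q_{del n₀}(g) = W_{λ,x₀}(g ⋆ g̃)` with `λ = zetaTable n₀ = Λ(n₀)/√n₀`, `x₀ = log n₀`, for every test `g`.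
[this work] -/
theorem deleteTable_quadratic_eq_siteQuadratic (n₀ : ℕ) {g : ℝ → ℂ} (hg : IsWeilTest g) :
    (tableDatum (deleteTable {n₀})).quadratic g = siteQuadratic (zetaTable n₀) (Real.log n₀) g := by
  obtain ⟨a, -, ha⟩ := hg.exists_tsupport_subset_Icc
  obtain ⟨N₁, hN₁⟩ := exists_window_le_log_succ_half a
  have hsupp : tsupport g ⊆
      Icc (-(Real.log ((max N₁ n₀ : ℕ) + 1 : ℝ) / 2)) (Real.log ((max N₁ n₀ : ℕ) + 1 : ℝ) / 2) := by
    have hmono : Real.log ((N₁ : ℝ) + 1) ≤ Real.log ((max N₁ n₀ : ℕ) + 1 : ℝ) := by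
      have h1 : (N₁ : ℝ) ≤ (max N₁ n₀ : ℕ) := by exact_mod_cast le_max_left N₁ n₀
      exact Real.log_le_log (by positivity) (by linarith)
    exact ha.trans (Icc_subset_Icc (by linarith) (by linarith))
  rw [tableDatum_quadratic_eq_add_sum zetaTable (deleteTable {n₀}) hg _ hsupp,
    tableDatum_zetaTable_quadratic, siteQuadratic_eq, Finset.sum_eq_single n₀]
  · simp [deleteTable]
  · intro n _ hn
    simp [deleteTable, hn]
  · intro h
    exact absurd (Finset.mem_range.2 (Nat.lt_succ_of_le (le_max_right N₁ n₀))) h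

/-- **THE DELETED DATUM IS EVENTUALLY NOT POSITIVE (RH-free, PROVED)** — the campaign's
"prime-deletion" perturbation in its own vocabulary: there is `N₀` such that for every prime power
`n ≥ N₀` the explicit datum `tableDatum (deleteTable {n})` fails `ExplicitDatum.Positivity`.  The
unperturbed datum `tableDatum zetaTable` is positive iff RH (`tableDatum_zetaTable_quadratic` +
Weil's criterion) — not claimed either way. [this work] -/
theorem deleteTable_not_positivity_eventually : ∃ N₀ : ℕ, ∀ n : ℕ, N₀ ≤ n →
    ArithmeticFunction.vonMangoldt n ≠ 0 → ¬ (tableDatum (deleteTable {n})).Positivity := by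
  obtain ⟨N₀, hN⟩ := primePower_deletion_exists_neg
  refine ⟨N₀, fun n hn hΛ hP ↦ ?_⟩
  obtain ⟨g, hg, hneg⟩ := hN n hn hΛ
  have h := hP g hg
  rw [deleteTable_quadratic_eq_siteQuadratic n hg] at h
  exact absurd h (not_le.2 hneg)

/-- **HAIRLINE FOR TABLES (RH-free)**: if a single-entry deletion `tableDatum (deleteTable {n})` is
positive on test functions then `Λ(n)/√n ≤ 2 ε(r)` for every `0 < r < (log n)/2`. [this work] -/
theorem zetaTable_le_of_deleteTable_positivity {n : ℕ}
    (hP : (tableDatum (deleteTable {n})).Positivity) {r : ℝ} (hr : 0 < r)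
    (hx : 2 * r < Real.log n) : zetaTable n ≤ 2 * weilGroundEnergy r := by
  have h := abs_le_two_mul_weilGroundEnergy_of_nonneg (lam := zetaTable n) (x₀ := Real.log n)
    (fun g hg ↦ by rw [← deleteTable_quadratic_eq_siteQuadratic n hg]; exact hP g hg) hr hx
  exact (le_abs_self _).trans h

end Summit.RiemannHypothesis.RiemannHypothesis.Theorems.PfPersistenceCoefficientRigidity

end
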